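import Summits.BirchSwinnertonDyer.BirchSwinnertonDyer.Theorems.AlignedTransportAtTwoOffStratumPartitionTwistFamilyZhaiOddLevel
import HarnessLib

/-!
# Route `AlignedTransportAtTwo`, crux C2 `MainConjectureOfRankZeroBSDAtTwo` (stmt-22298), line `birth` — EXPLICIT MEMBERS of the split Zhai sub-family
# for the other four small certified seeds: `BSD(W, 2)` IN PRINT for every minimal model of `2071a1^{(5)}`, `4087a1^{(73)}`, `4087c1^{(73)}`, `2045b1^{(69)}`

HONEST FRAMING (cell `bsd-f1-sign2`, WIDTH-5 attach seat `bsd-line-att-p4` g23; `--supports stmt-BirchSwinnertonDyer-22298 --as helper`).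
THEOREMS ONLY (no `def`, no named fact, no `sorry`). BSD is NOT proved; C1/C2/C3′ are NOT closed; nothing is asserted — every statement is
CONDITIONAL on the displayed PRINT named facts (hypotheses) and the seed's two displayed data.

WHY. Sequel of `…ZhaiExplicit` / `…ZhaiOddLevel` (same seat, same gen): one explicit representative of T_Z^split per remaining small seed, with BOTH
membership tests kernel-decided (`isInertIn_of_forall_ne_zero` by `decide` on the `u`-cubic mod `q`; `satisfiesHeegnerHypothesis_of_kronecker` by
`norm_num` on Jacobi symbols) and the odd-Manin binder discharged by Abbes–Ullmo (odd conductor). `u`-cubics (`(b₂, b₄, b₆)` from the tree's `c<seed>_b`):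
`2071a1`: `u³ − 3u² + 304u − 2048`, bad `19·109`, `M = 5`; `4087a1`: `u³ + u² − 599952u − 187010048`, bad `61·67`, `M = 73`; `4087c1`:
`u³ + 5u² − 64u + 192`, bad `61·67`, `M = 73` (same cubic field as `4087a1`'s — the census's aligned pair); `2045b1`: `u³ − 3u² − 87520u − 55211200`,
bad `5·409`, `M = 69 = 3·23`. Rows: **`bsdp_two_twist_2071a1_5`**, **`bsdp_two_twist_4087a1_73`**, **`bsdp_two_twist_4087c1_73`**, **`bsdp_two_twist_2045b1_69`**
— `BSDp W 2` for every globally minimal model `W` of the twist (conductors `2071·5²`, `4087·73²`, `4087·73²`, `2045·69²`), modulo PRINT⁶ {Zhai 2016 Thm. 1.1,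
Zhai arXiv v2 Thm. 1.2, Creutz–Miller 1.1, Abbes–Ullmo Thm. A, GZK, modularity} + displayed {`X₀(N_S)`-optimality datum of the seed, `ord₂(L(S,1)/Ω_∞(S)) = 0`}.
No Kato, no tower certificate, nothing about the member.

PARTITION CURRENCY (D-0171): unchanged; these are the first explicit points of T_Z^split for each small seed. Beyond-print theorem: no. BSD is NOT proved.

References: [Zhai2016] Thm. 1.1 and arXiv v2 Thm. 1.2; [AbbesUllmo1996] Thm. A; [CreutzMiller2012] Thm. 1.1; [Miller2011LMS] Def. 1.1; [Marcus2018] Ch. 3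
Thm. 25; [CremonaAlgorithms1997] Table 1.
-/

set_option autoImplicit false
set_option linter.dupNamespace false

noncomputable section

open scoped Classical MatrixGroups ModularForm

open CongruenceSubgroup WeierstrassCurve Polynomial NumberField IsDedekindDomain
open Literature.NumberTheory.EllipticCurves Literature.NumberTheory.EllipticCurves.ModularForms
open Literature.NumberTheory.EllipticCurves.Greenberg1999 Literature.NumberTheory.EllipticCurves.GreenbergVatsal2000
open Literature.NumberTheory.EllipticCurves.Rank1Residual Literature.NumberTheory.EllipticCurves.Rank1Residual.Typed
open Literature.NumberTheory.EllipticCurves.CoatesLiTianZhai2015 Literature.NumberTheory.EllipticCurves.Zhai2016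
open Summit.BirchSwinnertonDyer.Rank1Residual Summit.BirchSwinnertonDyer.Rank1Residual.F1Sign2
open Summit.BirchSwinnertonDyer.Rank1Residual.X1.MuLambda Summit.BirchSwinnertonDyer.Rank1Residual.X5
open Summit.BirchSwinnertonDyer.BirchSwinnertonDyer.Theorems.Rank1ResidualX1Defs
open Summit.BirchSwinnertonDyer.BirchSwinnertonDyer.Theses.AlignedTransportAtTwo
open Summit.BirchSwinnertonDyer.BirchSwinnertonDyer.Theorems.AlignedTransportAtTwoTwistFamilySmallSeeds
open Summit.BirchSwinnertonDyer.BirchSwinnertonDyer.Theorems.AlignedTransportAtTwoTwistFamilyZhai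
open Summit.BirchSwinnertonDyer.BirchSwinnertonDyer.Theorems.AlignedTransportAtTwoTwistFamilyZhaiSplit
open Summit.BirchSwinnertonDyer.BirchSwinnertonDyer.Theorems.AlignedTransportAtTwoTwistFamilyZhaiExplicit
open Summit.BirchSwinnertonDyer.BirchSwinnertonDyer.Theorems.AlignedTransportAtTwoTwistFamilyZhaiOddLevel
open Summit.BirchSwinnertonDyer.BirchSwinnertonDyer.Theorems.AlignedTransportAtTwoOffStratumRow2045b
open Summit.BirchSwinnertonDyer.BirchSwinnertonDyer.Theorems.TowerClass
open Summit.BirchSwinnertonDyer.BirchSwinnertonDyer.Theorems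

namespace Summit.BirchSwinnertonDyer.BirchSwinnertonDyer.Theorems.AlignedTransportAtTwoTwistFamilyZhaiExplicitSeeds

variable (W : WeierstrassCurve ℚ) [W.IsElliptic] [W.IsGloballyMinimal]
  (hmod : nonempty_modularParametrizationData) (hGZK : rank_eq_analyticRank_of_analyticRank_le_one)
  (hCM : bsdTriple_of_rank_le_one_of_conductor_lt)
  (h11 : thm11_ordTwo_LAlg_twist_eq_zero') (h12 : thm12v2_twoPartBSD_twist_of_split)
  (hAU : abbesUllmo_not_dvd_maninConstant_of_not_dvd_level)
  (F : Type) [Field F] [NumberField F]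

/-! ## `2071a1`: `M = 5` -/

/-- `5` is inert in the cubic field of `2071a1`: `u³ − 3u² + 304u − 2048 ≡ u³ + 2u² + 4u + 2` has no root mod `5` (`a₅(2071a1)` odd).
[cite: CremonaAlgorithms1997, Table 1] -/
theorem isInertIn_2071a1_5 (hF : IsTwoDivisionField c2071a1 F) : IsInertIn F 5 :=
  isInertIn_of_forall_ne_zero c2071a1 hF c2071a1_b.1 c2071a1_b.2.1 c2071a1_b.2.2 Nat.prime_five (by decide)

/-- `19` and `109` split in every quadratic field containing `√5`: `(5/19) = (5/109) = 1`. [cite: Marcus2018, Ch. 3 Thm. 25] -/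
theorem split_2071_5 (K : Type) [Field K] [NumberField K] (h2 : Module.finrank ℚ K = 2) (hx : ∃ x : K, x ^ 2 = ((5 : ℤ) : K)) :
    SatisfiesHeegnerHypothesis 2071 K := by
  refine satisfiesHeegnerHypothesis_of_kronecker (Int.squarefree_natCast.mpr Nat.prime_five.squarefree) (by decide) (by decide) 2071 ?_ K h2 hx
  intro p hp hpN
  have h2071 : (2071 : ℕ) = 19 * 109 := by norm_num
  rw [h2071] at hpN
  rcases (Nat.Prime.dvd_mul hp).mp hpN with h | h
  · have hp' : p = 19 := (Nat.prime_dvd_prime_iff_eq hp (by norm_num)).mp h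
    subst hp'
    exact ⟨fun h => absurd h (by norm_num), fun _ => by norm_num⟩
  · have hp' : p = 109 := (Nat.prime_dvd_prime_iff_eq hp (by norm_num)).mp h
    subst hp'
    exact ⟨fun h => absurd h (by norm_num), fun _ => by norm_num⟩

include hmod hGZK hCM h11 h12 hAU in
/-- **`BSD(W, 2)` IN PRINT for every globally minimal model `W` of `2071a1^{(5)}`** (conductor `2071·5² = 51775`), modulo PRINT⁶ {Zhai 1.1, Zhai v2 1.2,
Creutz–Miller 1.1, Abbes–Ullmo Thm. A, GZK, modularity} + displayed {`X₀(2071)`-optimality datum of `2071a1`, `ord₂(L(2071a1,1)/Ω_∞) = 0`}. CONDITIONAL;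
BSD is NOT proved. [cite: Zhai2016, Thm. 1.1 and arXiv:1409.0231v2 Thm. 1.2] [cite: AbbesUllmo1996, Thm. A] [cite: CreutzMiller2012, Thm. 1.1] [cite: Miller2011LMS, Def. 1.1] -/
theorem bsdp_two_twist_2071a1_5 [NeZero (c2071a1.conductorNorm ℤ)]
    (Dt : ModularParametrizationData c2071a1 (c2071a1.conductorNorm ℤ)) (hopt : Zhai2021.IsOptimalDatum c2071a1 Dt)
    (hL : ∃ x : ℚ, IsLAlg c2071a1 x ∧ x ≠ 0 ∧ padicValRat 2 x = 0) (hF : IsTwoDivisionField c2071a1 F)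
    {c : VariableChange ℚ} (hc : c • c2071a1.quadraticTwist ((5 : ℤ) : ℚ) = W) : BSDp W 2 := by
  have hpf : (5 : ℤ).natAbs.primeFactors = {5} := by
    rw [show (5 : ℤ).natAbs = 5 from rfl]; exact Nat.prime_five.primeFactors
  refine bsdp_two_twist_zhaiSplit_2071a1_oddLevel W hmod hGZK hCM h11 h12 hAU F 5 Dt hopt hL hF
    (Int.squarefree_natCast.mpr Nat.prime_five.squarefree) (by decide) (by decide) ?_ ?_ (split_2071_5) hc
  · rw [hpf]; exact Finset.singleton_nonempty _
  · intro q hq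
    rw [hpf, Finset.mem_singleton] at hq
    subst hq
    exact ⟨by norm_num, isInertIn_2071a1_5 F hF⟩

/-! ## `4087a1` and `4087c1`: `M = 73` -/

/-- `73` is inert in the cubic field of `4087a1`: `u³ + u² − 599952u − 187010048` has no root mod `73`. [cite: CremonaAlgorithms1997, Table 1] -/
theorem isInertIn_4087a1_73 (hF : IsTwoDivisionField c4087a1 F) : IsInertIn F 73 :=
  isInertIn_of_forall_ne_zero c4087a1 hF c4087a1_b.1 c4087a1_b.2.1 c4087a1_b.2.2 (by norm_num) (by decide)

/-- `73` is inert in the cubic field of `4087c1`: `u³ + 5u² − 64u + 192` has no root mod `73`. [cite: CremonaAlgorithms1997, Table 1] -/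
theorem isInertIn_4087c1_73 (hF : IsTwoDivisionField c4087c1 F) : IsInertIn F 73 :=
  isInertIn_of_forall_ne_zero c4087c1 hF c4087c1_b.1 c4087c1_b.2.1 c4087c1_b.2.2 (by norm_num) (by decide)

/-- `61` and `67` split in every quadratic field containing `√73`: `(73/61) = (73/67) = 1`. [cite: Marcus2018, Ch. 3 Thm. 25] -/
theorem split_4087_73 (K : Type) [Field K] [NumberField K] (h2 : Module.finrank ℚ K = 2) (hx : ∃ x : K, x ^ 2 = ((73 : ℤ) : K)) :
    SatisfiesHeegnerHypothesis 4087 K := by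
  refine satisfiesHeegnerHypothesis_of_kronecker (Int.squarefree_natCast.mpr (by norm_num : Nat.Prime 73).squarefree)
    (by decide) (by decide) 4087 ?_ K h2 hx
  intro p hp hpN
  have h4087 : (4087 : ℕ) = 61 * 67 := by norm_num
  rw [h4087] at hpN
  rcases (Nat.Prime.dvd_mul hp).mp hpN with h | h
  · have hp' : p = 61 := (Nat.prime_dvd_prime_iff_eq hp (by norm_num)).mp h
    subst hp'
    exact ⟨fun h => absurd h (by norm_num), fun _ => by norm_num⟩
  · have hp' : p = 67 := (Nat.prime_dvd_prime_iff_eq hp (by norm_num)).mp h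
    subst hp'
    exact ⟨fun h => absurd h (by norm_num), fun _ => by norm_num⟩

include hmod hGZK hCM h11 h12 hAU in
/-- **`BSD(W, 2)` IN PRINT for every globally minimal model `W` of `4087a1^{(73)}`** (conductor `4087·73²`), modulo PRINT⁶ + the two displayed data of
`4087a1`. CONDITIONAL; BSD is NOT proved. [cite: Zhai2016, Thm. 1.1 and arXiv:1409.0231v2 Thm. 1.2] [cite: AbbesUllmo1996, Thm. A] [cite: CreutzMiller2012, Thm. 1.1] -/
theorem bsdp_two_twist_4087a1_73 [NeZero (c4087a1.conductorNorm ℤ)]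
    (Dt : ModularParametrizationData c4087a1 (c4087a1.conductorNorm ℤ)) (hopt : Zhai2021.IsOptimalDatum c4087a1 Dt)
    (hL : ∃ x : ℚ, IsLAlg c4087a1 x ∧ x ≠ 0 ∧ padicValRat 2 x = 0) (hF : IsTwoDivisionField c4087a1 F)
    {c : VariableChange ℚ} (hc : c • c4087a1.quadraticTwist ((73 : ℤ) : ℚ) = W) : BSDp W 2 := by
  have hpf : (73 : ℤ).natAbs.primeFactors = {73} := by
    rw [show (73 : ℤ).natAbs = 73 from rfl]; exact (by norm_num : Nat.Prime 73).primeFactors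
  refine bsdp_two_twist_zhaiSplit_4087a1_oddLevel W hmod hGZK hCM h11 h12 hAU F 73 Dt hopt hL hF
    (Int.squarefree_natCast.mpr (by norm_num : Nat.Prime 73).squarefree) (by decide) (by decide) ?_ ?_ (split_4087_73) hc
  · rw [hpf]; exact Finset.singleton_nonempty _
  · intro q hq
    rw [hpf, Finset.mem_singleton] at hq
    subst hq
    exact ⟨by norm_num, isInertIn_4087a1_73 F hF⟩

include hmod hGZK hCM h11 h12 hAU in
/-- **`BSD(W, 2)` IN PRINT for every globally minimal model `W` of `4087c1^{(73)}`** (conductor `4087·73²`), modulo PRINT⁶ + the two displayed data of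
`4087c1`. CONDITIONAL; BSD is NOT proved. [cite: Zhai2016, Thm. 1.1 and arXiv:1409.0231v2 Thm. 1.2] [cite: AbbesUllmo1996, Thm. A] [cite: CreutzMiller2012, Thm. 1.1] -/
theorem bsdp_two_twist_4087c1_73 [NeZero (c4087c1.conductorNorm ℤ)]
    (Dt : ModularParametrizationData c4087c1 (c4087c1.conductorNorm ℤ)) (hopt : Zhai2021.IsOptimalDatum c4087c1 Dt)
    (hL : ∃ x : ℚ, IsLAlg c4087c1 x ∧ x ≠ 0 ∧ padicValRat 2 x = 0) (hF : IsTwoDivisionField c4087c1 F)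
    {c : VariableChange ℚ} (hc : c • c4087c1.quadraticTwist ((73 : ℤ) : ℚ) = W) : BSDp W 2 := by
  have hpf : (73 : ℤ).natAbs.primeFactors = {73} := by
    rw [show (73 : ℤ).natAbs = 73 from rfl]; exact (by norm_num : Nat.Prime 73).primeFactors
  refine bsdp_two_twist_zhaiSplit_4087c1_oddLevel W hmod hGZK hCM h11 h12 hAU F 73 Dt hopt hL hF
    (Int.squarefree_natCast.mpr (by norm_num : Nat.Prime 73).squarefree) (by decide) (by decide) ?_ ?_ (split_4087_73) hc
  · rw [hpf]; exact Finset.singleton_nonempty _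
  · intro q hq
    rw [hpf, Finset.mem_singleton] at hq
    subst hq
    exact ⟨by norm_num, isInertIn_4087c1_73 F hF⟩

/-! ## `2045b1`: `M = 69 = 3·23` -/

/-- `3` is inert in the cubic field of `2045b1`: `u³ − 3u² − 87520u − 55211200 ≡ u³ + 2u + 2` has no root mod `3`. [cite: CremonaAlgorithms1997, Table 1] -/
theorem isInertIn_2045b1_3 (hF : IsTwoDivisionField c2045b1 F) : IsInertIn F 3 :=
  isInertIn_of_forall_ne_zero c2045b1 hF c2045b1_b.1 c2045b1_b.2.1 c2045b1_b.2.2 Nat.prime_three (by decide)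

/-- `23` is inert in the cubic field of `2045b1` (no root of the `u`-cubic mod `23`). [cite: CremonaAlgorithms1997, Table 1] -/
theorem isInertIn_2045b1_23 (hF : IsTwoDivisionField c2045b1 F) : IsInertIn F 23 :=
  isInertIn_of_forall_ne_zero c2045b1 hF c2045b1_b.1 c2045b1_b.2.1 c2045b1_b.2.2 (by norm_num) (by decide)

/-- `5` and `409` split in every quadratic field containing `√69`: `(69/5) = (69/409) = 1`. [cite: Marcus2018, Ch. 3 Thm. 25] -/
theorem split_2045_69 (K : Type) [Field K] [NumberField K] (h2 : Module.finrank ℚ K = 2) (hx : ∃ x : K, x ^ 2 = ((69 : ℤ) : K)) :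
    SatisfiesHeegnerHypothesis 2045 K := by
  have hsq : Squarefree (69 : ℤ) := by
    have : (69 : ℤ) = ((3 * 23 : ℕ) : ℤ) := by norm_num
    rw [this]
    exact Int.squarefree_natCast.mpr
      ((Nat.squarefree_mul ((Nat.coprime_primes Nat.prime_three (by norm_num)).mpr (by norm_num))).mpr
        ⟨Nat.prime_three.squarefree, (by norm_num : Nat.Prime 23).squarefree⟩)
  refine satisfiesHeegnerHypothesis_of_kronecker hsq (by decide) (by decide) 2045 ?_ K h2 hx
  intro p hp hpN
  have h2045 : (2045 : ℕ) = 5 * 409 := by norm_num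
  rw [h2045] at hpN
  rcases (Nat.Prime.dvd_mul hp).mp hpN with h | h
  · have hp' : p = 5 := (Nat.prime_dvd_prime_iff_eq hp Nat.prime_five).mp h
    subst hp'
    exact ⟨fun h => absurd h (by norm_num), fun _ => by norm_num⟩
  · have hp' : p = 409 := (Nat.prime_dvd_prime_iff_eq hp (by norm_num)).mp h
    subst hp'
    exact ⟨fun h => absurd h (by norm_num), fun _ => by norm_num⟩

include hmod hGZK hCM h11 h12 hAU in
/-- **`BSD(W, 2)` IN PRINT for every globally minimal model `W` of `2045b1^{(69)}`** (`69 = 3·23`, both inert; conductor `2045·69²`), modulo PRINT⁶ + the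
two displayed data of `2045b1`. CONDITIONAL; BSD is NOT proved. [cite: Zhai2016, Thm. 1.1 and arXiv:1409.0231v2 Thm. 1.2] [cite: AbbesUllmo1996, Thm. A]
[cite: CreutzMiller2012, Thm. 1.1] -/
theorem bsdp_two_twist_2045b1_69 [NeZero (c2045b1.conductorNorm ℤ)]
    (Dt : ModularParametrizationData c2045b1 (c2045b1.conductorNorm ℤ)) (hopt : Zhai2021.IsOptimalDatum c2045b1 Dt)
    (hL : ∃ x : ℚ, IsLAlg c2045b1 x ∧ x ≠ 0 ∧ padicValRat 2 x = 0) (hF : IsTwoDivisionField c2045b1 F)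
    {c : VariableChange ℚ} (hc : c • c2045b1.quadraticTwist ((69 : ℤ) : ℚ) = W) : BSDp W 2 := by
  have hsq : Squarefree (69 : ℤ) := by
    have : (69 : ℤ) = ((3 * 23 : ℕ) : ℤ) := by norm_num
    rw [this]
    exact Int.squarefree_natCast.mpr
      ((Nat.squarefree_mul ((Nat.coprime_primes Nat.prime_three (by norm_num)).mpr (by norm_num))).mpr
        ⟨Nat.prime_three.squarefree, (by norm_num : Nat.Prime 23).squarefree⟩)
  refine bsdp_two_twist_zhaiSplit_2045b1_oddLevel W hmod hGZK hCM h11 h12 hAU F 69 Dt hopt hL hF hsq (by decide) (by decide) ?_ ?_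
    (split_2045_69) hc
  · exact ⟨3, Nat.mem_primeFactors.mpr ⟨Nat.prime_three, by norm_num, by norm_num⟩⟩
  · intro q hq
    obtain ⟨hqp, hqd, -⟩ := Nat.mem_primeFactors.mp hq
    rw [show (69 : ℤ).natAbs = 3 * 23 from rfl] at hqd
    rcases (Nat.Prime.dvd_mul hqp).mp hqd with h | h
    · have h3 : q = 3 := (Nat.prime_dvd_prime_iff_eq hqp Nat.prime_three).mp h
      subst h3
      exact ⟨by norm_num, isInertIn_2045b1_3 F hF⟩
    · have h23 : q = 23 := (Nat.prime_dvd_prime_iff_eq hqp (by norm_num)).mp h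
      subst h23
      exact ⟨by norm_num, isInertIn_2045b1_23 F hF⟩

end Summit.BirchSwinnertonDyer.BirchSwinnertonDyer.Theorems.AlignedTransportAtTwoTwistFamilyZhaiExplicitSeeds

end
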